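import Summits.ABC.IUTFork.LDHGenuinePerImageSzpiroGoodLowHeight
import Literature.IUT.LogVolume.Corollary22RatPointDictionary
import HarnessLib

/-!
# The fork at [IUTchIII] Corollary 3.12, L-DH level, READING (P): the HEX family `λ_k = 1/2 + 2/7^k`, `k ≤ 12`, is SZPIRO-GOOD at
# EVERY prime `l` — so the (P)- and (U)-line cruxes are KERNEL THEOREMS at every genuine Θ-datum of `(λ_k, l)`, every `l ≥ 5`,
# HYPOTHESIS-FREE (abc-iut cell, crux ThetaPartII = stmt-ABC-19678, stub `stub_cor312PerImage`)

Record-only PROOF file (D-0012) of the abc-iut cell (WAVE-3 discharge seat abc-iut-c312-d1, gen 8; row «HEX-SZPIRO-KERNEL» = gen 7's desk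
memo HEX-SZPIRO-MARGINS.md made kernel; the NUM-side certificate for R-W's WINDOW-TABLE column «szpiro_margin»). TAKES NO SIDE on [IUTchIII]
Cor. 3.12. Part B (p446147) proved `Cor22.cor312PerImageAtDatum_of_szpiroSix` (`d_mod = 1`: a Szpiro-type bound with constant `→ 6` implies
the (P)-line crux); part H (p451532) discharged it at `λ = 11/14` from local heights `≤ 5`. For `k ≥ 3` the local height of `λ_k` at `7` is
`2k > 5`, so HERE the Szpiro RATIO itself is certified, by the rational-point dictionary `Corollary22RatPointDictionary.lean` (p462751:
`log q^{∤2l}(λ) ≤ R·log 𝔣^{∤2l}(λ)` for EVERY prime `l` from ONE inequality of natural numbers `D·M ≤ rad(D)^R` on the factorised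
denominator `D` of `j(λ)`):

* `Cor22.cor312PerImageAtDatum_of_prime_imp` — a genuine Θ-datum at `(P, l)` carries `l` prime ([IUTchI] Def. 3.1 (c));
* **`Cor22.cor312PerImageAtDatum_of_logQ_le_mul`** — `λ ∈ U_X`, `d_mod = 1`, `l ≥ 5`, `log q^{∤2l} ≤ R·log 𝔣^{∤2l}`, `R ≤ 6(l−1)(l+1)/((l+4)(l−3))`
  (`R = 5` always qualifies: `five_le_szpiroSixConst`) ⟹ `Cor22.Cor312PerImageAtDatum P l`; **`Cor22.not_szpiroBad_of_logQ_le_mul`** — the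
  same hypothesis REFUTES the Szpiro-bad GUARD of the cut certificates (`Cor22.forall_cor312Of_of_szpiroBad` p449008; records p450130 /
  p452637 / p453137): there the binders `hNumBad` / `hSHwBad` / `hregBad` demand NOTHING;
* **`Cor22.szpiroFive_ratPoint_of_certificate`**, **`Cor22.cor312_ratPoint_of_szpiroFive`**, `Cor22.not_szpiroBad_ratPoint_of_szpiroFive` —
  for `q ∈ ℚ ∖ {0,1}` with `j(q) = N/∏_{p∈I} p^{e_p}` (odd primes `p ∤ N`), `p^5 ≤ M·p^{e_p}` on `I` and `D·M ≤ (∏_{p∈I} p)^5`: ratio `5` at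
  every prime `l`, hence `Cor312PerImageAtDatum (ratPoint q) l ∧ Cor312AtDatum (ratPoint q) l` for EVERY `l ≥ 5`, guard false;
* **`Cor22.szpiroFive_ratPoint_lamSeven_one` … `_twelve`**, **`…_of_le_twelve`**, **`Cor22.cor312_ratPoint_lamSeven_of_le_twelve`**,
  **`Cor22.not_szpiroBad_ratPoint_lamSeven_of_le_twelve`** — the HEX family: for EVERY `1 ≤ k ≤ 12` and EVERY `l ≥ 5`, [IUTchIII] Cor. 3.12
  AS TYPED — per image (P) and for the union (U) — HOLDS at every genuine Θ-volume datum of `(λ_k, l)`, and the Szpiro-bad guard is false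
  at every prime `l ≥ 5`: these WINDOW-TABLE rows (the family's undecided strip U2, `k ≤ 9`, included) consume NO hypothesis in the cut
  certificates. Certificates: `j(λ_k) = 2⁶(3·7^{2k}+16)³/(7^{2k}(7^k+4)²(7^k−4)²)` with the complete prime factorisations of `7^k ± 4`
  (largest prime `40353611 = 7⁹ + 4`, certified by `norm_num`); desk: the worst ratio after removing the place over `l` is `< 3.7`.

HONEST SCOPE. `Cor312PerImageAtDatum P l` quantifies over the genuine Θ-volume data at `(P, l)`; it is contentful exactly when such data
exist (admissibility — [IUTchI] Def. 3.1, e.g. `SL₂ ⊆` Galois image — is NOT certified here for any particular `(k, l)`; abc-iut-w5-d044's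
`Cor22.exists_admissible_prime_ratPoint_lamSeven` gives admissible `(λ_k, l)` for all large `k`). So: WHATEVER Θ-data exist at `(λ_k, l)`,
`k ≤ 12`, the disputed inequality holds there as typed. Nothing here asserts the existence of data, Cor. 3.12 in general, or abc; proved-as-
typed ≠ in print. [cite: Mochizuki2012, IUTchIII Cor. 3.12 p. 173–174; IUTchIV Thm. 1.10 p. 22–23, Cor. 2.2 (ii) proof p. 44–46]
[cite: MochizukiGenEll2010, Ex. 1.3 (i) p. 5, Def. 3.3 p. 12] [claim: Mochizuki2012, status: disputed] for every IUT quotation. PROOF-ONLY.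
-/

noncomputable section

namespace Literature.IUT.LogVolume.Cor22

open NumberField IsDedekindDomain Literature.NumberTheory.DiophantineGeometry
open Literature.NumberTheory.DiophantineGeometry.GenEll Summit.ABC.IUTFork

variable {P : NFPoint} {l : ℕ}

/-! ## 1. Bridges: a Szpiro RATIO at every prime `l` ⟹ the cruxes at every `l ≥ 5`, and the Szpiro-bad guard is false -/

/-- A genuine Θ-volume datum at `(P, l)` carries "`l` is a prime number" ([IUTchI] Def. 3.1 (c), field `l_prime` of the initial
Θ-data), so `Cor22.Cor312PerImageAtDatum P l` may be proved under the extra hypothesis `l` prime. [cite: Mochizuki2012, IUTchI Def. 3.1 (c)]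
[claim: Mochizuki2012, status: disputed] -/
theorem cor312PerImageAtDatum_of_prime_imp (h : l.Prime → Cor312PerImageAtDatum P l) :
    Cor312PerImageAtDatum P l := fun T => by
  letI := T.instFieldF; letI := T.instNumberFieldF; letI := T.instAlgebraF; letI := T.instFieldK
  letI := T.instNumberFieldK; letI := T.instAlgebraK; letI := T.instFieldFbar; letI := T.instAlgebraFbar
  letI := T.instAlgebraKFbar; letI := T.instIsElliptic
  exact h T.D.l_prime T

/-- `5 ≤ 6(l−1)(l+1)/((l+4)(l−3))` for every `l ≥ 5` (`6(l²−1) − 5(l+4)(l−3) = l² − 5l + 54 > 0`). [folklore] -/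
theorem five_le_szpiroSixConst (h5 : 5 ≤ l) :
    (5 : ℝ) ≤ 6 * ((l : ℝ) - 1) * ((l : ℝ) + 1) / (((l : ℝ) + 4) * ((l : ℝ) - 3)) := by
  have hl5 : (5 : ℝ) ≤ l := by exact_mod_cast h5
  have hden : 0 < ((l : ℝ) + 4) * ((l : ℝ) - 3) := by nlinarith
  rw [le_div_iff₀ hden]
  nlinarith

/-- **From a Szpiro RATIO to part B's Szpiro-type bound** (`l ≥ 5`, `R ≤ 6(l−1)(l+1)/((l+4)(l−3)) = (6l(l+1)/((l+4)(l−3)))·(1 − 1/l)`,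
`log-diff ≥ 0`, `log π ≥ 0`). [cite: Mochizuki2012, IUTchIV Thm 1.10 p.23] [claim: Mochizuki2012, status: disputed] -/
theorem logQ_le_szpiroSixBound_of_logQ_le_mul (h5 : 5 ≤ l) {R : ℝ}
    (hRl : R ≤ 6 * ((l : ℝ) - 1) * ((l : ℝ) + 1) / (((l : ℝ) + 4) * ((l : ℝ) - 3)))
    (hq : logQAvoid P {2, l} ≤ R * logCondAvoid P {2, l}) :
    logQAvoid P {2, l} ≤
      6 * l * ((l : ℝ) + 1) / (((l : ℝ) + 4) * ((l : ℝ) - 3))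
          * (P.logDiff + (1 - 1 / (l : ℝ)) * logCondAvoid P {2, l})
        + 6 * l * ((l : ℝ) + 5) / (((l : ℝ) + 4) * ((l : ℝ) - 3)) * Real.log Real.pi := by
  have hl5 : (5 : ℝ) ≤ l := by exact_mod_cast h5
  have hl0 : (0 : ℝ) < l := by linarith
  have hden : 0 < ((l : ℝ) + 4) * ((l : ℝ) - 3) := by nlinarith
  have hC0 : 0 ≤ logCondAvoid P {2, l} := logCondAvoid_nonneg P _
  have hD0 : 0 ≤ P.logDiff := P.logDiff_nonneg
  have hpi0 : 0 ≤ Real.log Real.pi := Real.log_nonneg (by linarith [Real.pi_gt_three])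
  have hc1 : 0 ≤ 6 * l * ((l : ℝ) + 1) / (((l : ℝ) + 4) * ((l : ℝ) - 3)) :=
    div_nonneg (by positivity) hden.le
  have hc2 : 0 ≤ 6 * l * ((l : ℝ) + 5) / (((l : ℝ) + 4) * ((l : ℝ) - 3)) :=
    div_nonneg (by positivity) hden.le
  have hkey : 6 * l * ((l : ℝ) + 1) / (((l : ℝ) + 4) * ((l : ℝ) - 3)) * (1 - 1 / (l : ℝ)) =
      6 * ((l : ℝ) - 1) * ((l : ℝ) + 1) / (((l : ℝ) + 4) * ((l : ℝ) - 3)) := by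
    field_simp
  have h1 : R * logCondAvoid P {2, l} ≤
      6 * l * ((l : ℝ) + 1) / (((l : ℝ) + 4) * ((l : ℝ) - 3)) * ((1 - 1 / (l : ℝ)) * logCondAvoid P {2, l}) := by
    rw [← mul_assoc, hkey]
    exact mul_le_mul_of_nonneg_right hRl hC0
  have h2 : 0 ≤ 6 * l * ((l : ℝ) + 1) / (((l : ℝ) + 4) * ((l : ℝ) - 3)) * P.logDiff := mul_nonneg hc1 hD0
  have h3 : 0 ≤ 6 * l * ((l : ℝ) + 5) / (((l : ℝ) + 4) * ((l : ℝ) - 3)) * Real.log Real.pi := mul_nonneg hc2 hpi0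
  nlinarith [hq, h1, h2, h3]

/-- **THE (P)-LINE CRUX FROM A SZPIRO RATIO**: `λ ∈ U_X`, `d_mod = 1`, `l ≥ 5`, `log q^{∤2l} ≤ R·log 𝔣^{∤2l}` with
`R ≤ 6(l−1)(l+1)/((l+4)(l−3))` ⟹ `Cor22.Cor312PerImageAtDatum P l` (part B's `cor312PerImageAtDatum_of_szpiroSix`).
[cite: Mochizuki2012, IUTchIII Cor. 3.12 p. 173–174] [claim: Mochizuki2012, status: disputed] -/
theorem cor312PerImageAtDatum_of_logQ_le_mul (hU : P.InU) (h5 : 5 ≤ l) (hd : dmod P = 1) {R : ℝ}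
    (hRl : R ≤ 6 * ((l : ℝ) - 1) * ((l : ℝ) + 1) / (((l : ℝ) + 4) * ((l : ℝ) - 3)))
    (hq : logQAvoid P {2, l} ≤ R * logCondAvoid P {2, l}) : Cor312PerImageAtDatum P l :=
  cor312PerImageAtDatum_of_szpiroSix hU h5 hd (logQ_le_szpiroSixBound_of_logQ_le_mul h5 hRl hq)

/-- **THE SZPIRO-BAD GUARD IS FALSE** at such `(P, l)` (`d_mod = 1`, `l ≥ 5`, `log q^{∤2l} ≤ R·log 𝔣^{∤2l}`, `R` as above): the
antecedent of `Cor22.forall_cor312Of_of_szpiroBad` (p449008) — the guard of the binders `hNumBad` / `hSHwBad` / `hregBad` of the cut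
certificates — is refuted, so they demand nothing at `(P, l)`. [cite: Mochizuki2012, IUTchIII Cor. 3.12 p. 173–174] [claim: Mochizuki2012, status: disputed] -/
theorem not_szpiroBad_of_logQ_le_mul (h5 : 5 ≤ l) (hd : dmod P = 1) {R : ℝ}
    (hRl : R ≤ 6 * ((l : ℝ) - 1) * ((l : ℝ) + 1) / (((l : ℝ) + 4) * ((l : ℝ) - 3)))
    (hq : logQAvoid P {2, l} ≤ R * logCondAvoid P {2, l}) :
    ¬ (((l : ℝ) + 5) / 4 < (dmod P : ℝ) ∨
        6 * l * (((l : ℝ) + 5) - 4 * dmod P) / (((l : ℝ) + 4) * ((l : ℝ) - 3))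
            * (P.logDiff + (1 - 1 / (l : ℝ)) * logCondAvoid P {2, l})
          + 6 * l * ((l : ℝ) + 5) / (((l : ℝ) + 4) * ((l : ℝ) - 3)) * Real.log Real.pi < logQAvoid P {2, l}) := by
  have hdR : (dmod P : ℝ) = 1 := by exact_mod_cast hd
  have hl5 : (5 : ℝ) ≤ l := by exact_mod_cast h5
  have hb := logQ_le_szpiroSixBound_of_logQ_le_mul (P := P) h5 hRl hq
  rw [hdR]
  have e : ((l : ℝ) + 5) - 4 * 1 = (l : ℝ) + 1 := by ring
  rw [e]
  rintro (h | h)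
  · linarith
  · linarith

/-! ## 2. Rational points: the certificate `D·M ≤ rad(D)^5` closes BOTH cruxes at every `l ≥ 5` -/

section RatPoint

variable {q : ℚ} {N D M : ℕ} {I : Finset ℕ} {e : ℕ → ℕ}

/-- **Szpiro ratio `5` at a rational point from ONE inequality** (packaging of the dictionary's uniform certificate): `j(q) = N/D`,
`D = ∏_{p∈I} p^{e_p}` with, for every `p ∈ I`: `p` prime, `e_p ≥ 1`, `p ∤ N`, `p^5 ≤ M·p^{e_p}`; `2 ∉ I`; `D·M ≤ (∏_{p∈I} p)^5` ⟹
`log q^{∤2l}(q) ≤ 5·log 𝔣^{∤2l}(q)` for EVERY prime `l`. [cite: Mochizuki2012, IUTchIV Thm 1.10 p.23] [claim: Mochizuki2012, status: disputed] -/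
theorem szpiroFive_ratPoint_of_certificate
    (hall : ∀ p ∈ I, p.Prime ∧ e p ≠ 0 ∧ ¬ p ∣ N ∧ p ^ 5 ≤ M * p ^ e p)
    (hD : D = ∏ p ∈ I, p ^ e p) (hj : jInv q = (N : ℚ) / (D : ℚ)) (hN : N ≠ 0) (h2 : 2 ∉ I) (hM0 : 0 < M)
    (hmain : D * M ≤ (∏ p ∈ I, p) ^ 5) {l : ℕ} (hl : l.Prime) :
    logQAvoid (ratPoint q) {2, l} ≤ 5 * logCondAvoid (ratPoint q) {2, l} := by
  have h := logQAvoid_ratPoint_le_mul_logCondAvoid_of_prime (fun p hp => (hall p hp).1) (fun p hp => (hall p hp).2.1)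
    hD hj hN (fun p hp => (hall p hp).2.2.1) h2 hM0 (fun p hp => (hall p hp).2.2.2) hmain hl
  exact_mod_cast h

/-- **BOTH CRUXES at a Szpiro-good rational point, every `l ≥ 5`**: `q ∈ ℚ ∖ {0, 1}` with `log q^{∤2l}(q) ≤ 5·log 𝔣^{∤2l}(q)` at every
prime `l` ⟹ `Cor22.Cor312PerImageAtDatum (ratPoint q) l` AND `Cor22.Cor312AtDatum (ratPoint q) l` for every `l ≥ 5`.
[cite: Mochizuki2012, IUTchIII Cor. 3.12 p. 173–174] [claim: Mochizuki2012, status: disputed] -/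
theorem cor312_ratPoint_of_szpiroFive (hq0 : q ≠ 0) (hq1 : q ≠ 1)
    (h : ∀ l : ℕ, l.Prime → logQAvoid (ratPoint q) {2, l} ≤ 5 * logCondAvoid (ratPoint q) {2, l}) (h5 : 5 ≤ l) :
    Cor312PerImageAtDatum (ratPoint q) l ∧ Cor312AtDatum (ratPoint q) l := by
  have hUP := ratPoint_mem_UPle_one hq0 hq1
  have hP : Cor312PerImageAtDatum (ratPoint q) l :=
    cor312PerImageAtDatum_of_prime_imp fun hl =>
      cor312PerImageAtDatum_of_logQ_le_mul hUP.1.1 h5 (dmod_eq_one_of_degree_le_one (le_of_eq (degree_ratPoint _)))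
        (five_le_szpiroSixConst h5) (h l hl)
  exact ⟨hP, cor312AtDatum_of_perImage hP⟩

/-- … and the Szpiro-bad GUARD of the cut certificates is FALSE at `(ratPoint q, l)` for every prime `l ≥ 5`.
[cite: Mochizuki2012, IUTchIII Cor. 3.12 p. 173–174] [claim: Mochizuki2012, status: disputed] -/
theorem not_szpiroBad_ratPoint_of_szpiroFive
    (h : ∀ l : ℕ, l.Prime → logQAvoid (ratPoint q) {2, l} ≤ 5 * logCondAvoid (ratPoint q) {2, l})
    (hl : l.Prime) (h5 : 5 ≤ l) :
    ¬ (((l : ℝ) + 5) / 4 < (dmod (ratPoint q) : ℝ) ∨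
        6 * l * (((l : ℝ) + 5) - 4 * dmod (ratPoint q)) / (((l : ℝ) + 4) * ((l : ℝ) - 3))
            * ((ratPoint q).logDiff + (1 - 1 / (l : ℝ)) * logCondAvoid (ratPoint q) {2, l})
          + 6 * l * ((l : ℝ) + 5) / (((l : ℝ) + 4) * ((l : ℝ) - 3)) * Real.log Real.pi
          < logQAvoid (ratPoint q) {2, l}) :=
  not_szpiroBad_of_logQ_le_mul h5 (dmod_eq_one_of_degree_le_one (le_of_eq (degree_ratPoint _)))
    (five_le_szpiroSixConst h5) (h l hl)

end RatPoint

/-- **`k = 1`**: `λ_{1} = 1/2 + 2/7^1` is SZPIRO-GOOD with ratio `5` at EVERY prime `l` — `log q^{∤2l}(λ_{1}) ≤ 5·log 𝔣^{∤2l}(λ_{1})`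
(bad primes `{3, 7, 11}`, local heights `h_3 = 2, h_7 = 2, h_11 = 2`). [cite: Mochizuki2012, IUTchIV Thm 1.10 p.23] [claim: Mochizuki2012, status: disputed] -/
theorem szpiroFive_ratPoint_lamSeven_one {l : ℕ} (hl : l.Prime) :
    logQAvoid (ratPoint ((2 : ℚ)⁻¹ + 2 / 7 ^ 1)) {2, l} ≤ 5 * logCondAvoid (ratPoint ((2 : ℚ)⁻¹ + 2 / 7 ^ 1)) {2, l} :=
  szpiroFive_ratPoint_of_certificate (N := 277167808)
    (D := 53361) (M := 1331)
    (I := {3, 7, 11}) (e := fun _ => 2)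
    (by
      intro p hp
      simp only [Finset.mem_insert, Finset.mem_singleton] at hp
      rcases hp with rfl | rfl | rfl <;> norm_num)
    (by rw [Finset.prod_insert (by decide), Finset.prod_insert (by decide), Finset.prod_singleton]; norm_num)
    (by norm_num [jInv]) (by norm_num) (by decide) (by norm_num)
    (by rw [Finset.prod_insert (by decide), Finset.prod_insert (by decide), Finset.prod_singleton]; norm_num) hl

/-- **`k = 2`**: `λ_{2} = 1/2 + 2/7^2` is SZPIRO-GOOD with ratio `5` at EVERY prime `l` — `log q^{∤2l}(λ_{2}) ≤ 5·log 𝔣^{∤2l}(λ_{2})`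
(bad primes `{3, 5, 7, 53}`, local heights `h_3 = 4, h_5 = 2, h_7 = 4, h_53 = 2`). [cite: Mochizuki2012, IUTchIV Thm 1.10 p.23] [claim: Mochizuki2012, status: disputed] -/
theorem szpiroFive_ratPoint_lamSeven_two {l : ℕ} (hl : l.Prime) :
    logQAvoid (ratPoint ((2 : ℚ)⁻¹ + 2 / 7 ^ 2)) {2, l} ≤ 5 * logCondAvoid (ratPoint ((2 : ℚ)⁻¹ + 2 / 7 ^ 2)) {2, l} :=
  szpiroFive_ratPoint_of_certificate (N := 24077483805376)
    (D := 13657428225) (M := 148877)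
    (I := {3, 5, 7, 53}) (e := fun p => if p = 3 then 4 else if p = 7 then 4 else 2)
    (by
      intro p hp
      simp only [Finset.mem_insert, Finset.mem_singleton] at hp
      rcases hp with rfl | rfl | rfl | rfl <;> norm_num)
    (by rw [Finset.prod_insert (by decide), Finset.prod_insert (by decide), Finset.prod_insert (by decide), Finset.prod_singleton]; norm_num)
    (by norm_num [jInv]) (by norm_num) (by decide) (by norm_num)
    (by rw [Finset.prod_insert (by decide), Finset.prod_insert (by decide), Finset.prod_insert (by decide), Finset.prod_singleton]; norm_num) hl

/-- **`k = 3`**: `λ_{3} = 1/2 + 2/7^3` is SZPIRO-GOOD with ratio `5` at EVERY prime `l` — `log q^{∤2l}(λ_{3}) ≤ 5·log 𝔣^{∤2l}(λ_{3})`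
(bad primes `{3, 7, 113, 347}`, local heights `h_3 = 2, h_7 = 6, h_113 = 2, h_347 = 2`). [cite: Mochizuki2012, IUTchIV Thm 1.10 p.23] [claim: Mochizuki2012, status: disputed] -/
theorem szpiroFive_ratPoint_lamSeven_three {l : ℕ} (hl : l.Prime) :
    logQAvoid (ratPoint ((2 : ℚ)⁻¹ + 2 / 7 ^ 3)) {2, l} ≤ 5 * logCondAvoid (ratPoint ((2 : ℚ)⁻¹ + 2 / 7 ^ 3)) {2, l} :=
  szpiroFive_ratPoint_of_certificate (N := 2814281398446102208)
    (D := 1627970706838161) (M := 41781923)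
    (I := {3, 7, 113, 347}) (e := fun p => if p = 7 then 6 else 2)
    (by
      intro p hp
      simp only [Finset.mem_insert, Finset.mem_singleton] at hp
      rcases hp with rfl | rfl | rfl | rfl <;> norm_num)
    (by rw [Finset.prod_insert (by decide), Finset.prod_insert (by decide), Finset.prod_insert (by decide), Finset.prod_singleton]; norm_num)
    (by norm_num [jInv]) (by norm_num) (by decide) (by norm_num)
    (by rw [Finset.prod_insert (by decide), Finset.prod_insert (by decide), Finset.prod_insert (by decide), Finset.prod_singleton]; norm_num) hl

/-- **`k = 4`**: `λ_{4} = 1/2 + 2/7^4` is SZPIRO-GOOD with ratio `5` at EVERY prime `l` — `log q^{∤2l}(λ_{4}) ≤ 5·log 𝔣^{∤2l}(λ_{4})`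
(bad primes `{3, 5, 7, 13, 17, 37, 47}`, local heights `h_3 = 2, h_5 = 2, h_7 = 8, h_13 = 2, h_17 = 2, h_37 = 2, h_47 = 2`). [cite: Mochizuki2012, IUTchIV Thm 1.10 p.23] [claim: Mochizuki2012, status: disputed] -/
theorem szpiroFive_ratPoint_lamSeven_four {l : ℕ} (hl : l.Prime) :
    logQAvoid (ratPoint ((2 : ℚ)⁻¹ + 2 / 7 ^ 4)) {2, l} ≤ 5 * logCondAvoid (ratPoint ((2 : ℚ)⁻¹ + 2 / 7 ^ 4)) {2, l} :=
  szpiroFive_ratPoint_of_certificate (N := 331053286650533207171776)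
    (D := 191580167928263976225) (M := 103823)
    (I := {3, 5, 7, 13, 17, 37, 47}) (e := fun p => if p = 7 then 8 else 2)
    (by
      intro p hp
      simp only [Finset.mem_insert, Finset.mem_singleton] at hp
      rcases hp with rfl | rfl | rfl | rfl | rfl | rfl | rfl <;> norm_num)
    (by rw [Finset.prod_insert (by decide), Finset.prod_insert (by decide), Finset.prod_insert (by decide), Finset.prod_insert (by decide), Finset.prod_insert (by decide), Finset.prod_insert (by decide), Finset.prod_singleton]; norm_num)
    (by norm_num [jInv]) (by norm_num) (by decide) (by norm_num)
    (by rw [Finset.prod_insert (by decide), Finset.prod_insert (by decide), Finset.prod_insert (by decide), Finset.prod_insert (by decide), Finset.prod_insert (by decide), Finset.prod_insert (by decide), Finset.prod_singleton]; norm_num) hl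

/-- **`k = 5`**: `λ_{5} = 1/2 + 2/7^5` is SZPIRO-GOOD with ratio `5` at EVERY prime `l` — `log q^{∤2l}(λ_{5}) ≤ 5·log 𝔣^{∤2l}(λ_{5})`
(bad primes `{3, 7, 1867, 16811}`, local heights `h_3 = 4, h_7 = 10, h_1867 = 2, h_16811 = 2`). [cite: Mochizuki2012, IUTchIV Thm 1.10 p.23] [claim: Mochizuki2012, status: disputed] -/
theorem szpiroFive_ratPoint_lamSeven_five {l : ℕ} (hl : l.Prime) :
    logQAvoid (ratPoint ((2 : ℚ)⁻¹ + 2 / 7 ^ 5)) {2, l} ≤ 5 * logCondAvoid (ratPoint ((2 : ℚ)⁻¹ + 2 / 7 ^ 5)) {2, l} :=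
  szpiroFive_ratPoint_of_certificate (N := 38947982228412842224874876608)
    (D := 22539337737339808877942961) (M := 4750952019731)
    (I := {3, 7, 1867, 16811}) (e := fun p => if p = 3 then 4 else if p = 7 then 10 else 2)
    (by
      intro p hp
      simp only [Finset.mem_insert, Finset.mem_singleton] at hp
      rcases hp with rfl | rfl | rfl | rfl <;> norm_num)
    (by rw [Finset.prod_insert (by decide), Finset.prod_insert (by decide), Finset.prod_insert (by decide), Finset.prod_singleton]; norm_num)
    (by norm_num [jInv]) (by norm_num) (by decide) (by norm_num)
    (by rw [Finset.prod_insert (by decide), Finset.prod_insert (by decide), Finset.prod_insert (by decide), Finset.prod_singleton]; norm_num) hl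

/-- **`k = 6`**: `λ_{6} = 1/2 + 2/7^6` is SZPIRO-GOOD with ratio `5` at EVERY prime `l` — `log q^{∤2l}(λ_{6}) ≤ 5·log 𝔣^{∤2l}(λ_{6})`
(bad primes `{3, 5, 7, 11, 23, 29, 31, 4057}`, local heights `h_3 = 2, h_5 = 2, h_7 = 12, h_11 = 2, h_23 = 2, h_29 = 2, h_31 = 2, h_4057 = 2`). [cite: Mochizuki2012, IUTchIV Thm 1.10 p.23] [claim: Mochizuki2012, status: disputed] -/
theorem szpiroFive_ratPoint_lamSeven_six {l : ℕ} (hl : l.Prime) :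
    logQAvoid (ratPoint ((2 : ℚ)⁻¹ + 2 / 7 ^ 6)) {2, l} ≤ 5 * logCondAvoid (ratPoint ((2 : ℚ)⁻¹ + 2 / 7 ^ 6)) {2, l} :=
  szpiroFive_ratPoint_of_certificate (N := 4582190906942319086485033474538176)
    (D := 2651730839729054071144267644225) (M := 66775173193)
    (I := {3, 5, 7, 11, 23, 29, 31, 4057}) (e := fun p => if p = 7 then 12 else 2)
    (by
      intro p hp
      simp only [Finset.mem_insert, Finset.mem_singleton] at hp
      rcases hp with rfl | rfl | rfl | rfl | rfl | rfl | rfl | rfl <;> norm_num)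
    (by rw [Finset.prod_insert (by decide), Finset.prod_insert (by decide), Finset.prod_insert (by decide), Finset.prod_insert (by decide), Finset.prod_insert (by decide), Finset.prod_insert (by decide), Finset.prod_insert (by decide), Finset.prod_singleton]; norm_num)
    (by norm_num [jInv]) (by norm_num) (by decide) (by norm_num)
    (by rw [Finset.prod_insert (by decide), Finset.prod_insert (by decide), Finset.prod_insert (by decide), Finset.prod_insert (by decide), Finset.prod_insert (by decide), Finset.prod_insert (by decide), Finset.prod_insert (by decide), Finset.prod_singleton]; norm_num) hl

/-- **`k = 7`**: `λ_{7} = 1/2 + 2/7^7` is SZPIRO-GOOD with ratio `5` at EVERY prime `l` — `log q^{∤2l}(λ_{7}) ≤ 5·log 𝔣^{∤2l}(λ_{7})`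
(bad primes `{3, 7, 223, 1231, 823547}`, local heights `h_3 = 2, h_7 = 14, h_223 = 2, h_1231 = 2, h_823547 = 2`). [cite: Mochizuki2012, IUTchIV Thm 1.10 p.23] [claim: Mochizuki2012, status: disputed] -/
theorem szpiroFive_ratPoint_lamSeven_seven {l : ℕ} (hl : l.Prime) :
    logQAvoid (ratPoint ((2 : ℚ)⁻¹ + 2 / 7 ^ 7)) {2, l} ≤ 5 * logCondAvoid (ratPoint ((2 : ℚ)⁻¹ + 2 / 7 ^ 7)) {2, l} :=
  szpiroFive_ratPoint_of_certificate (N := 539090177400406925371187774610891491008)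
    (D := 311973482269822802132072268177367761) (M := 558554002799688323)
    (I := {3, 7, 223, 1231, 823547}) (e := fun p => if p = 7 then 14 else 2)
    (by
      intro p hp
      simp only [Finset.mem_insert, Finset.mem_singleton] at hp
      rcases hp with rfl | rfl | rfl | rfl | rfl <;> norm_num)
    (by rw [Finset.prod_insert (by decide), Finset.prod_insert (by decide), Finset.prod_insert (by decide), Finset.prod_insert (by decide), Finset.prod_singleton]; norm_num)
    (by norm_num [jInv]) (by norm_num) (by decide) (by norm_num)
    (by rw [Finset.prod_insert (by decide), Finset.prod_insert (by decide), Finset.prod_insert (by decide), Finset.prod_insert (by decide), Finset.prod_singleton]; norm_num) hl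

/-- **`k = 8`**: `λ_{8} = 1/2 + 2/7^8` is SZPIRO-GOOD with ratio `5` at EVERY prime `l` — `log q^{∤2l}(λ_{8}) ≤ 5·log 𝔣^{∤2l}(λ_{8})`
(bad primes `{3, 5, 7, 41, 61, 89, 461, 2399}`, local heights `h_3 = 6, h_5 = 2, h_7 = 16, h_41 = 2, h_61 = 2, h_89 = 2, h_461 = 2, h_2399 = 2`). [cite: Mochizuki2012, IUTchIV Thm 1.10 p.23] [claim: Mochizuki2012, status: disputed] -/
theorem szpiroFive_ratPoint_lamSeven_eight {l : ℕ} (hl : l.Prime) :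
    logQAvoid (ratPoint ((2 : ℚ)⁻¹ + 2 / 7 ^ 8)) {2, l} ≤ 5 * logCondAvoid (ratPoint ((2 : ℚ)⁻¹ + 2 / 7 ^ 8)) {2, l} :=
  szpiroFive_ratPoint_of_certificate (N := 63423420279514783978783305481778223789904576)
    (D := 36703368217258783755654414078982116432225) (M := 13806727199)
    (I := {3, 5, 7, 41, 61, 89, 461, 2399}) (e := fun p => if p = 3 then 6 else if p = 7 then 16 else 2)
    (by
      intro p hp
      simp only [Finset.mem_insert, Finset.mem_singleton] at hp
      rcases hp with rfl | rfl | rfl | rfl | rfl | rfl | rfl | rfl <;> norm_num)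
    (by rw [Finset.prod_insert (by decide), Finset.prod_insert (by decide), Finset.prod_insert (by decide), Finset.prod_insert (by decide), Finset.prod_insert (by decide), Finset.prod_insert (by decide), Finset.prod_insert (by decide), Finset.prod_singleton]; norm_num)
    (by norm_num [jInv]) (by norm_num) (by decide) (by norm_num)
    (by rw [Finset.prod_insert (by decide), Finset.prod_insert (by decide), Finset.prod_insert (by decide), Finset.prod_insert (by decide), Finset.prod_insert (by decide), Finset.prod_insert (by decide), Finset.prod_insert (by decide), Finset.prod_singleton]; norm_num) hl

/-- **`k = 9`**: `λ_{9} = 1/2 + 2/7^9` is SZPIRO-GOOD with ratio `5` at EVERY prime `l` — `log q^{∤2l}(λ_{9}) ≤ 5·log 𝔣^{∤2l}(λ_{9})`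
(bad primes `{3, 7, 13451201, 40353611}`, local heights `h_3 = 2, h_7 = 18, h_13451201 = 2, h_40353611 = 2`). [cite: Mochizuki2012, IUTchIV Thm 1.10 p.23] [claim: Mochizuki2012, status: disputed] -/
theorem szpiroFive_ratPoint_lamSeven_nine {l : ℕ} (hl : l.Prime) :
    logQAvoid (ratPoint ((2 : ℚ)⁻¹ + 2 / 7 ^ 9)) {2, l} ≤ 5 * logCondAvoid (ratPoint ((2 : ℚ)⁻¹ + 2 / 7 ^ 9)) {2, l} :=
  szpiroFive_ratPoint_of_certificate (N := 7461701972461115697707412800778261237222223945408)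
    (D := 4318114567396351708648225589213505039869112561) (M := 65712381904499392038131)
    (I := {3, 7, 13451201, 40353611}) (e := fun p => if p = 7 then 18 else 2)
    (by
      intro p hp
      simp only [Finset.mem_insert, Finset.mem_singleton] at hp
      rcases hp with rfl | rfl | rfl | rfl <;> norm_num)
    (by rw [Finset.prod_insert (by decide), Finset.prod_insert (by decide), Finset.prod_insert (by decide), Finset.prod_singleton]; norm_num)
    (by norm_num [jInv]) (by norm_num) (by decide) (by norm_num)
    (by rw [Finset.prod_insert (by decide), Finset.prod_insert (by decide), Finset.prod_insert (by decide), Finset.prod_singleton]; norm_num) hl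

/-- **`k = 10`**: `λ_{10} = 1/2 + 2/7^10` is SZPIRO-GOOD with ratio `5` at EVERY prime `l` — `log q^{∤2l}(λ_{10}) ≤ 5·log 𝔣^{∤2l}(λ_{10})`
(bad primes `{3, 5, 7, 13, 113, 431, 3361, 2499781}`, local heights `h_3 = 2, h_5 = 2, h_7 = 20, h_13 = 2, h_113 = 2, h_431 = 2, h_3361 = 2, h_2499781 = 2`). [cite: Mochizuki2012, IUTchIV Thm 1.10 p.23] [claim: Mochizuki2012, status: disputed] -/
theorem szpiroFive_ratPoint_lamSeven_ten {l : ℕ} (hl : l.Prime) :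
    logQAvoid (ratPoint ((2 : ℚ)⁻¹ + 2 / 7 ^ 10)) {2, l} ≤ 5 * logCondAvoid (ratPoint ((2 : ℚ)⁻¹ + 2 / 7 ^ 10)) {2, l} :=
  szpiroFive_ratPoint_of_certificate (N := 877861775358069351306186883155847630690384768857270976)
    (D := 508021860739623161584403848563341384866682258340225) (M := 15620894109696996541)
    (I := {3, 5, 7, 13, 113, 431, 3361, 2499781}) (e := fun p => if p = 7 then 20 else 2)
    (by
      intro p hp
      simp only [Finset.mem_insert, Finset.mem_singleton] at hp
      rcases hp with rfl | rfl | rfl | rfl | rfl | rfl | rfl | rfl <;> norm_num)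
    (by rw [Finset.prod_insert (by decide), Finset.prod_insert (by decide), Finset.prod_insert (by decide), Finset.prod_insert (by decide), Finset.prod_insert (by decide), Finset.prod_insert (by decide), Finset.prod_insert (by decide), Finset.prod_singleton]; norm_num)
    (by norm_num [jInv]) (by norm_num) (by decide) (by norm_num)
    (by rw [Finset.prod_insert (by decide), Finset.prod_insert (by decide), Finset.prod_insert (by decide), Finset.prod_insert (by decide), Finset.prod_insert (by decide), Finset.prod_insert (by decide), Finset.prod_insert (by decide), Finset.prod_singleton]; norm_num) hl

/-- **`k = 11`**: `λ_{11} = 1/2 + 2/7^11` is SZPIRO-GOOD with ratio `5` at EVERY prime `l` — `log q^{∤2l}(λ_{11}) ≤ 5·log 𝔣^{∤2l}(λ_{11})`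
(bad primes `{3, 7, 11, 383, 12163, 14779, 573637}`, local heights `h_3 = 4, h_7 = 22, h_11 = 2, h_383 = 2, h_12163 = 2, h_14779 = 2, h_573637 = 2`). [cite: Mochizuki2012, IUTchIV Thm 1.10 p.23] [claim: Mochizuki2012, status: disputed] -/
theorem szpiroFive_ratPoint_lamSeven_eleven {l : ℕ} (hl : l.Prime) :
    logQAvoid (ratPoint ((2 : ℚ)⁻¹ + 2 / 7 ^ 11)) {2, l} ≤ 5 * logCondAvoid (ratPoint ((2 : ℚ)⁻¹ + 2 / 7 ^ 11)) {2, l} :=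
  szpiroFive_ratPoint_of_certificate (N := 103279560009101480824780025162880297188765886873499000239808)
    (D := 59768263894155948817615699043423182017453393232817177361) (M := 188760651494385853)
    (I := {3, 7, 11, 383, 12163, 14779, 573637}) (e := fun p => if p = 3 then 4 else if p = 7 then 22 else 2)
    (by
      intro p hp
      simp only [Finset.mem_insert, Finset.mem_singleton] at hp
      rcases hp with rfl | rfl | rfl | rfl | rfl | rfl | rfl <;> norm_num)
    (by rw [Finset.prod_insert (by decide), Finset.prod_insert (by decide), Finset.prod_insert (by decide), Finset.prod_insert (by decide), Finset.prod_insert (by decide), Finset.prod_insert (by decide), Finset.prod_singleton]; norm_num)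
    (by norm_num [jInv]) (by norm_num) (by decide) (by norm_num)
    (by rw [Finset.prod_insert (by decide), Finset.prod_insert (by decide), Finset.prod_insert (by decide), Finset.prod_insert (by decide), Finset.prod_insert (by decide), Finset.prod_insert (by decide), Finset.prod_singleton]; norm_num) hl

/-- **`k = 12`**: `λ_{12} = 1/2 + 2/7^12` is SZPIRO-GOOD with ratio `5` at EVERY prime `l` — `log q^{∤2l}(λ_{12}) ≤ 5·log 𝔣^{∤2l}(λ_{12})`
(bad primes `{3, 5, 7, 17, 71, 149, 157, 1657, 6961, 39217}`, local heights `h_3 = 2, h_5 = 2, h_7 = 24, h_17 = 2, h_71 = 2, h_149 = 2, h_157 = 2, h_1657 = 2, h_6961 = 2, h_39217 = 2`). [cite: Mochizuki2012, IUTchIV Thm 1.10 p.23] [claim: Mochizuki2012, status: disputed] -/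
theorem szpiroFive_ratPoint_lamSeven_twelve {l : ℕ} (hl : l.Prime) :
    logQAvoid (ratPoint ((2 : ℚ)⁻¹ + 2 / 7 ^ 12)) {2, l} ≤ 5 * logCondAvoid (ratPoint ((2 : ℚ)⁻¹ + 2 / 7 ^ 12)) {2, l} :=
  szpiroFive_ratPoint_of_certificate (N := 12150736955510780068845358405743800966603214912637562392580637376)
    (D := 7031676478883553278820042958523470501193469845431405141368225) (M := 60314690631313)
    (I := {3, 5, 7, 17, 71, 149, 157, 1657, 6961, 39217}) (e := fun p => if p = 7 then 24 else 2)
    (by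
      intro p hp
      simp only [Finset.mem_insert, Finset.mem_singleton] at hp
      rcases hp with rfl | rfl | rfl | rfl | rfl | rfl | rfl | rfl | rfl | rfl <;> norm_num)
    (by rw [Finset.prod_insert (by decide), Finset.prod_insert (by decide), Finset.prod_insert (by decide), Finset.prod_insert (by decide), Finset.prod_insert (by decide), Finset.prod_insert (by decide), Finset.prod_insert (by decide), Finset.prod_insert (by decide), Finset.prod_insert (by decide), Finset.prod_singleton]; norm_num)
    (by norm_num [jInv]) (by norm_num) (by decide) (by norm_num)
    (by rw [Finset.prod_insert (by decide), Finset.prod_insert (by decide), Finset.prod_insert (by decide), Finset.prod_insert (by decide), Finset.prod_insert (by decide), Finset.prod_insert (by decide), Finset.prod_insert (by decide), Finset.prod_insert (by decide), Finset.prod_insert (by decide), Finset.prod_singleton]; norm_num) hl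

/-! ## The family `λ_k`, `1 ≤ k ≤ 12`: Szpiro-good at every prime `l`; BOTH cruxes at every `l ≥ 5`; the guard is false -/

/-- **THE HEX FAMILY IS SZPIRO-GOOD, `k ≤ 12`**: `log q^{∤2l}(λ_k) ≤ 5·log 𝔣^{∤2l}(λ_k)` for every `1 ≤ k ≤ 12` and EVERY prime `l`
(`λ_k = 1/2 + 2/7^k`). [cite: Mochizuki2012, IUTchIV Thm 1.10 p.23] [claim: Mochizuki2012, status: disputed] -/
theorem szpiroFive_ratPoint_lamSeven_of_le_twelve {k : ℕ} (hk1 : 1 ≤ k) (hk : k ≤ 12) {l : ℕ} (hl : l.Prime) :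
    logQAvoid (ratPoint ((2 : ℚ)⁻¹ + 2 / 7 ^ k)) {2, l} ≤
      5 * logCondAvoid (ratPoint ((2 : ℚ)⁻¹ + 2 / 7 ^ k)) {2, l} := by
  interval_cases k
  · exact szpiroFive_ratPoint_lamSeven_one hl
  · exact szpiroFive_ratPoint_lamSeven_two hl
  · exact szpiroFive_ratPoint_lamSeven_three hl
  · exact szpiroFive_ratPoint_lamSeven_four hl
  · exact szpiroFive_ratPoint_lamSeven_five hl
  · exact szpiroFive_ratPoint_lamSeven_six hl
  · exact szpiroFive_ratPoint_lamSeven_seven hl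
  · exact szpiroFive_ratPoint_lamSeven_eight hl
  · exact szpiroFive_ratPoint_lamSeven_nine hl
  · exact szpiroFive_ratPoint_lamSeven_ten hl
  · exact szpiroFive_ratPoint_lamSeven_eleven hl
  · exact szpiroFive_ratPoint_lamSeven_twelve hl

/-- **[IUTchIII] COR. 3.12 AS TYPED HOLDS AT EVERY GENUINE Θ-DATUM OF `(λ_k, l)`, `1 ≤ k ≤ 12`, `l ≥ 5` — per image (reading (P),
`Cor22.Cor312PerImageAtDatum`) AND for the union (reading (U), `Cor22.Cor312AtDatum`), HYPOTHESIS-FREE.** Contentful exactly when Θ-data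
exist at `(λ_k, l)` (admissibility not certified here). [cite: Mochizuki2012, IUTchIII Cor. 3.12 p. 173–174] [claim: Mochizuki2012, status: disputed] -/
theorem cor312_ratPoint_lamSeven_of_le_twelve {k : ℕ} (hk1 : 1 ≤ k) (hk : k ≤ 12) {l : ℕ} (h5 : 5 ≤ l) :
    Cor312PerImageAtDatum (ratPoint ((2 : ℚ)⁻¹ + 2 / 7 ^ k)) l ∧ Cor312AtDatum (ratPoint ((2 : ℚ)⁻¹ + 2 / 7 ^ k)) l :=
  cor312_ratPoint_of_szpiroFive (lamSeven_ne hk1).1 (lamSeven_ne hk1).2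
    (fun _ hl => szpiroFive_ratPoint_lamSeven_of_le_twelve hk1 hk hl) h5

/-- **THE SZPIRO-BAD GUARD IS FALSE ON THE HEX ROWS `k ≤ 12`**: for `1 ≤ k ≤ 12` and every prime `l ≥ 5`, neither `(l+5)/4 < d_mod(λ_k)`
nor `(6l(l+5−4d_mod)/((l+4)(l−3)))·(log-diff(λ_k) + (1 − 1/l)·log 𝔣^{∤2l}(λ_k)) + (6l(l+5)/((l+4)(l−3)))·log π < log q^{∤2l}(λ_k)`:
the binders `hNumBad` / `hSHwBad` / `hregBad` of the cut certificates of record (p450130, p452637, p453137 — all guarded by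
`Cor22.forall_cor312Of_of_szpiroBad`) demand NOTHING at these WINDOW-TABLE rows. [cite: Mochizuki2012, IUTchIII Cor. 3.12 p. 173–174]
[claim: Mochizuki2012, status: disputed] -/
theorem not_szpiroBad_ratPoint_lamSeven_of_le_twelve {k : ℕ} (hk1 : 1 ≤ k) (hk : k ≤ 12) {l : ℕ} (hl : l.Prime)
    (h5 : 5 ≤ l) :
    ¬ (((l : ℝ) + 5) / 4 < (dmod (ratPoint ((2 : ℚ)⁻¹ + 2 / 7 ^ k)) : ℝ) ∨
        6 * l * (((l : ℝ) + 5) - 4 * dmod (ratPoint ((2 : ℚ)⁻¹ + 2 / 7 ^ k))) / (((l : ℝ) + 4) * ((l : ℝ) - 3))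
            * ((ratPoint ((2 : ℚ)⁻¹ + 2 / 7 ^ k)).logDiff
                + (1 - 1 / (l : ℝ)) * logCondAvoid (ratPoint ((2 : ℚ)⁻¹ + 2 / 7 ^ k)) {2, l})
          + 6 * l * ((l : ℝ) + 5) / (((l : ℝ) + 4) * ((l : ℝ) - 3)) * Real.log Real.pi
          < logQAvoid (ratPoint ((2 : ℚ)⁻¹ + 2 / 7 ^ k)) {2, l}) :=
  not_szpiroBad_ratPoint_of_szpiroFive (fun _ hl' => szpiroFive_ratPoint_lamSeven_of_le_twelve hk1 hk hl') hl h5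

end Literature.IUT.LogVolume.Cor22
end
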